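import Summits.FinalStateConjecture.FinalStateConjecture.Theses.RobustClausewiseGenericity
import Summits.FinalStateConjecture.FinalStateConjecture.Theorems.RobustClausewiseGenericityAssembly
import HarnessLib

/-!
# Crux `CensorshipRobust` (stmt-FinalStateConjecture-10131) — typed decomposition (BC2 redirect)
# `CensorshipWalls → TameAxisSuperposition → CensorshipRobust`

Landed verbatim by a prover seat (2026-08-17) from the crux-strategist workfile
`Cruxes/CensorshipRobust/StrategySplit.lean` (seat `planner-cstrat-stmt-FinalStateConjecture-10131-r1-0`), written in
the shape `C₁ → C₂ → C` for `ledger route edit --split CensorshipRobust … --glue-by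
Summit.FinalStateConjecture.FinalStateConjecture.Theorems.RobustClausewiseGenericity.censorshipRobust_of_subs`.

The deciding crux `CensorshipRobust` of route `RobustClausewiseGenericity` (weak cosmic censorship in ROBUST
positive-codimension form: `Q_B` = "every MGHD has complete `𝓘⁺`" is robustly escapable at every admissible
datum) is the conjunction of two typed pieces of different nature, neither of which is the crux or the summit:

* `C₁ = CensorshipWalls` — WALL STRUCTURE OF THE NAKED-SINGULARITY STRATUM (the physics; the shape of
  Christodoulou 1999, Thm 4.1, and of the Angelopoulos–Kehle–Unger `C¹` threshold): at every admissible `d` there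
  are finitely many functionals `Λⱼ : data → ℝ` such that (i) `Λⱼ ∘ G` is differentiable at the base point for
  every tame probe `G` through `d`; (iii) each `Λⱼ` is CROSSABLE, `d(Λⱼ ∘ γⱼ)(0) ≠ 0` for some tame curve `γⱼ`;
  (ii) along every tame probe `G` there is `δ > 0` such that every `G c` with `‖c‖ < δ` lying off all the walls
  (`Λⱼ (G c) ≠ Λⱼ d` for all `j`) has `Q_B`.
* `C₂ = TameAxisSuperposition` — JOINT REALISATION OF COMPACTLY SUPPORTED ADMISSIBLE DEFORMATIONS (constraint
  gluing à la Corvino–Schoen / Chruściel–Delay, no censorship content): a tame probe `G : ℝᵐ → data` and a tame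
  curve `γ` through `d` sit in one tame probe `G₁`, `G₁ ∘ L = G` (`L` injective linear), with `γ` a LOCAL
  coordinate axis: `G₁ (L₁ s) = γ s` for `‖s‖ < ε`.

The assembly `censorshipRobust_of_subs` is NOT a one-line seam: (1) by induction on `j ≤ J` it enriches the given
probe, one wall at a time, to a tame probe TRANSVERSE to all walls (`d(Λᵢ ∘ G')(0) ≠ 0`): old walls stay
transverse by the chain rule through the injective linear map of the enrichment, the new one becomes transverse
because `γⱼ` is a local axis (`Filter.EventuallyEq.fderiv_eq` + chain rule); (2) in every further tame
enrichment `G₂` the pull-backs `ℓⱼ = d(Λⱼ ∘ G₂)(0)` are non-zero functionals (chain rule again), the direction set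
`⋂ⱼ {v | ℓⱼ v ≠ 0}` is open and dense (finite intersection of complements of closed hyperplanes,
`dense_setOf_apply_ne_zero`, `dense_iInter_of_isOpen`), and along each of its directions the ray `t ↦ G₂ (t • v)`
leaves every wall for small `t ≠ 0` (`HasDerivAt.eventually_ne`, first-order Taylor) while staying `δ`-close, so
`Q_B (G₂ (t • v))` by (ii). Stated first for an abstract property `Q` over the named legend
`Theorems.RobustClausewiseGenericity.{Tame, RobustlyEscapable}` (`robustlyEscapable_of_dataWalls`), then
specialised verbatim to the two piece statements (`censorshipRobust_of_subs`).

No `def`s; unconditional; standard axioms; no named facts.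

## References

* D. Christodoulou, *On the global initial value problem and the issue of singularities*, CQG 16 (1999)
  A23–A35, p. A24; *The instability of naked singularities …*, Ann. Math. 149 (1999) 183–217, Thm 4.1.
  [Christodoulou1999, Christodoulou1999instability]
* Y. Angelopoulos, C. Kehle, R. Unger, arXiv:2603.10378, Thm 2 (a `C¹` threshold hypersurface; the final
  parameter ratio a `C¹` submersion — the model wall). [AngelopoulosKehleUnger2026]
* J. Corvino, R. Schoen, *On the asymptotics for the vacuum Einstein constraint equations*, JDG 73 (2006);
  P. T. Chruściel, E. Delay, Mém. SMF 94 (2003) (local structure of the space of solutions of the constraints —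
  the content of `TameAxisSuperposition`). [CorvinoSchoen2006, ChruscielDelay2003]
-/

noncomputable section

namespace Summit.FinalStateConjecture.FinalStateConjecture.Theorems.RobustClausewiseGenericity

open Literature.Geometry.Lorentzian
open Set Function Filter Metric
open scoped Manifold ContDiff Topology

-- D-0017: single-problem summit, `Summit.<S>.<S>.…` by design.
set_option linter.dupNamespace false

section DataWalls

variable {X : Type} [TopologicalSpace X] [ChartedSpace E3 X] [IsManifold (𝓡 3) ∞ X]

/-- **Data-space walls + local axis superposition ⇒ robust escapability** (abstract property `Q`).
Hypotheses: finitely many functionals `Λⱼ` on data, (i) differentiable at the base point along every tame probe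
through `d`, (iii) each crossable by a tame curve, (ii) capturing the `Q`-bad data near the base point of every
tame probe inside the union of their level sets through `d`; and the superposition principle at `d` (every tame
probe and tame curve sit in one tame probe with the curve as a local axis). Conclusion: `Q` is robustly escapable
at `d`. Proof: transversal enrichment by induction on the walls, then general position (see the module
docstring). [cite: Christodoulou1999, p. A24] -/
theorem robustlyEscapable_of_dataWalls {d : InitialDataSet (𝓡 3) X} {Q : InitialDataSet (𝓡 3) X → Prop}
    {J : ℕ} (Λ : Fin J → InitialDataSet (𝓡 3) X → ℝ)
    (hdiff : ∀ (m : ℕ) (G : EuclideanSpace ℝ (Fin m) → InitialDataSet (𝓡 3) X), Tame d m G →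
      ∀ j, DifferentiableAt ℝ (Λ j ∘ G) 0)
    (hcross : ∀ j, ∃ γ : EuclideanSpace ℝ (Fin 1) → InitialDataSet (𝓡 3) X,
      Tame d 1 γ ∧ fderiv ℝ (Λ j ∘ γ) 0 ≠ 0)
    (hwall : ∀ (m : ℕ) (G : EuclideanSpace ℝ (Fin m) → InitialDataSet (𝓡 3) X), Tame d m G →
      ∃ δ : ℝ, 0 < δ ∧ ∀ c, ‖c‖ < δ → (∀ j, Λ j (G c) ≠ Λ j d) → Q (G c))
    (hsup : ∀ (m : ℕ) (G : EuclideanSpace ℝ (Fin m) → InitialDataSet (𝓡 3) X)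
      (γ : EuclideanSpace ℝ (Fin 1) → InitialDataSet (𝓡 3) X), Tame d m G → Tame d 1 γ →
      ∃ (n : ℕ) (G₁ : EuclideanSpace ℝ (Fin n) → InitialDataSet (𝓡 3) X)
        (L : EuclideanSpace ℝ (Fin m) →ₗ[ℝ] EuclideanSpace ℝ (Fin n))
        (L₁ : EuclideanSpace ℝ (Fin 1) →ₗ[ℝ] EuclideanSpace ℝ (Fin n)),
        Function.Injective L ∧ Tame d n G₁ ∧ (∀ c, G₁ (L c) = G c) ∧
        ∃ ε : ℝ, 0 < ε ∧ ∀ s, ‖s‖ < ε → G₁ (L₁ s) = γ s) :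
    RobustlyEscapable d Q := by
  intro m G hG
  /- Step 1 — TRANSVERSAL ENRICHMENT: by induction on `j ≤ J`, a tame enrichment of `G` along which the first
  `j` walls are transverse at the base point. -/
  have key : ∀ j : ℕ, j ≤ J →
      ∃ (n : ℕ) (G' : EuclideanSpace ℝ (Fin n) → InitialDataSet (𝓡 3) X)
        (L : EuclideanSpace ℝ (Fin m) →ₗ[ℝ] EuclideanSpace ℝ (Fin n)),
        Function.Injective L ∧ Tame d n G' ∧ (∀ c, G' (L c) = G c) ∧
        ∀ i : Fin J, (i : ℕ) < j → fderiv ℝ (Λ i ∘ G') 0 ≠ 0 := by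
    intro j
    induction j with
    | zero =>
      intro _
      exact ⟨m, G, LinearMap.id, fun a b h => h, hG, fun c => rfl, fun i hi => absurd hi (Nat.not_lt_zero _)⟩
    | succ j ih =>
      intro hj
      obtain ⟨n, G', L, hL, hG', hGL, htr⟩ := ih (Nat.le_of_succ_le hj)
      have hjJ : j < J := Nat.lt_of_succ_le hj
      obtain ⟨γ, hγ, hγd⟩ := hcross ⟨j, hjJ⟩
      obtain ⟨n', G'', L', L₁, hL', hG'', hGL', ε, hε, hax⟩ := hsup n G' γ hG' hγ
      refine ⟨n', G'', L' ∘ₗ L, fun a b h => hL (hL' h), hG'',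
        fun c => by rw [LinearMap.comp_apply, hGL', hGL], fun i hi => ?_⟩
      -- `Λ i ∘ G''` is differentiable at the base point (hypothesis (i) on the tame probe `G''`)
      have hd'' : DifferentiableAt ℝ (Λ i ∘ G'') 0 := hdiff n' G'' hG'' i
      rcases (Nat.lt_succ_iff.1 hi).lt_or_eq with hlt | heq
      · -- an OLD wall: `Λ i ∘ G' = (Λ i ∘ G'') ∘ L'`, chain rule
        intro h0
        apply htr i hlt
        have hcomp : Λ i ∘ G' = (Λ i ∘ G'') ∘ ⇑(LinearMap.toContinuousLinearMap L') := by
          funext c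
          simp only [Function.comp_apply, LinearMap.coe_toContinuousLinearMap', hGL']
        have hdL : DifferentiableAt ℝ (Λ i ∘ G'') ((LinearMap.toContinuousLinearMap L') 0) := by
          rw [map_zero]; exact hd''
        rw [hcomp, fderiv_comp (0 : EuclideanSpace ℝ (Fin n)) hdL
          (LinearMap.toContinuousLinearMap L').differentiableAt, ContinuousLinearMap.fderiv, map_zero, h0,
          ContinuousLinearMap.zero_comp]
      · -- the NEW wall `i = ⟨j, hjJ⟩`: `γ` is a local axis of `G''`
        have hieq : i = ⟨j, hjJ⟩ := Fin.ext heq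
        subst hieq
        intro h0
        apply hγd
        have hloc : (Λ ⟨j, hjJ⟩ ∘ γ) =ᶠ[𝓝 0]
            ((Λ ⟨j, hjJ⟩ ∘ G'') ∘ ⇑(LinearMap.toContinuousLinearMap L₁)) := by
          filter_upwards [Metric.ball_mem_nhds (0 : EuclideanSpace ℝ (Fin 1)) hε] with s hs
          rw [Metric.mem_ball, dist_zero_right] at hs
          simp only [Function.comp_apply, LinearMap.coe_toContinuousLinearMap', hax s hs]
        have hdL : DifferentiableAt ℝ (Λ ⟨j, hjJ⟩ ∘ G'') ((LinearMap.toContinuousLinearMap L₁) 0) := by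
          rw [map_zero]; exact hd''
        rw [hloc.fderiv_eq, fderiv_comp (0 : EuclideanSpace ℝ (Fin 1)) hdL
          (LinearMap.toContinuousLinearMap L₁).differentiableAt, ContinuousLinearMap.fderiv, map_zero, h0,
          ContinuousLinearMap.zero_comp]
  obtain ⟨n, G', L, hL, hG', hGL, htr⟩ := key J le_rfl
  refine ⟨n, G', L, hL, hG', hGL, fun p G₂ L' hL' hT₂ hGL₂ => ?_⟩
  /- Step 2 — GENERAL POSITION in the further enrichment `G₂`. -/
  have hd₂ : ∀ j, DifferentiableAt ℝ (Λ j ∘ G₂) 0 := hdiff p G₂ hT₂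
  -- the pulled-back differentials are non-zero functionals (chain rule through `L'`)
  have hℓne : ∀ j, fderiv ℝ (Λ j ∘ G₂) 0 ≠ 0 := by
    intro j h0
    apply htr j j.isLt
    have hcomp : Λ j ∘ G' = (Λ j ∘ G₂) ∘ ⇑(LinearMap.toContinuousLinearMap L') := by
      funext c
      simp only [Function.comp_apply, LinearMap.coe_toContinuousLinearMap', hGL₂]
    have hdL : DifferentiableAt ℝ (Λ j ∘ G₂) ((LinearMap.toContinuousLinearMap L') 0) := by
      rw [map_zero]; exact hd₂ j
    rw [hcomp, fderiv_comp (0 : EuclideanSpace ℝ (Fin n)) hdL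
      (LinearMap.toContinuousLinearMap L').differentiableAt, ContinuousLinearMap.fderiv, map_zero, h0,
      ContinuousLinearMap.zero_comp]
  -- the open dense set of directions transverse to every wall
  have hUo : ∀ j, IsOpen {v : EuclideanSpace ℝ (Fin p) | fderiv ℝ (Λ j ∘ G₂) 0 v ≠ 0} := fun j =>
    isOpen_ne_fun (fderiv ℝ (Λ j ∘ G₂) 0).continuous continuous_const
  have hUd : ∀ j, Dense {v : EuclideanSpace ℝ (Fin p) | fderiv ℝ (Λ j ∘ G₂) 0 v ≠ 0} := by
    intro j
    obtain ⟨w, hw⟩ := DFunLike.ne_iff.1 (hℓne j)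
    exact dense_setOf_apply_ne_zero _ (by simpa using hw)
  refine ⟨⋂ j, {v | fderiv ℝ (Λ j ∘ G₂) 0 v ≠ 0}, isOpen_iInter_of_finite hUo,
    dense_iInter_of_isOpen hUo hUd, fun v hv => ?_⟩
  have hvj : ∀ j, fderiv ℝ (Λ j ∘ G₂) 0 v ≠ 0 := fun j => Set.mem_iInter.1 hv j
  obtain ⟨δ, hδ, hgood⟩ := hwall p G₂ hT₂
  -- along `t ↦ G₂ (t • v)` every wall is left for small `t ≠ 0` (first-order Taylor) …
  have hev : ∀ᶠ t in 𝓝[≠] (0 : ℝ), ∀ j, Λ j (G₂ (t • v)) ≠ Λ j d := by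
    refine Filter.eventually_all.2 fun j => ?_
    have h1 : HasDerivAt (fun s : ℝ => s • v) ((1 : ℝ) • v) 0 := (hasDerivAt_id (0 : ℝ)).smul_const v
    rw [one_smul] at h1
    have h2 : HasFDerivAt (Λ j ∘ G₂) (fderiv ℝ (Λ j ∘ G₂) 0) ((0 : ℝ) • v) := by
      rw [zero_smul]; exact (hd₂ j).hasFDerivAt
    exact (h2.comp_hasDerivAt (0 : ℝ) h1).eventually_ne (hvj j)
  -- … while the ray stays `δ`-close to the base point
  have hev' : ∀ᶠ t in 𝓝[≠] (0 : ℝ), ‖t • v‖ < δ := by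
    have hc : Continuous fun t : ℝ => ‖t • v‖ := (continuous_id.smul continuous_const).norm
    have h0 : ‖(0 : ℝ) • v‖ < δ := by rw [zero_smul, norm_zero]; exact hδ
    exact (hc.continuousAt.eventually_lt continuousAt_const h0).filter_mono nhdsWithin_le_nhds
  have hQ : ∀ᶠ t in 𝓝[≠] (0 : ℝ), Q (G₂ (t • v)) :=
    (hev.and hev').mono fun t ht => hgood _ ht.2 ht.1
  rw [eventually_nhdsWithin_iff, Metric.eventually_nhds_iff] at hQ
  obtain ⟨δ', hδ', h⟩ := hQ
  exact ⟨δ', hδ', fun t ht htδ => h (by simpa [Real.dist_eq] using htδ) ht⟩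

end DataWalls

/-- **Glue of the typed decomposition of `CensorshipRobust` (stmt-FinalStateConjecture-10131):
`CensorshipWalls → TameAxisSuperposition → CensorshipRobust`**, the two hypotheses being VERBATIM the
statements of the route's split children (so that `--glue-by` renders
`theorem … : CensorshipWalls → TameAxisSuperposition → CensorshipRobust := censorshipRobust_of_subs`).
Unfold the legend and apply `robustlyEscapable_of_dataWalls` with `Q := Q_B`. [cite: Christodoulou1999, p. A24] -/
theorem censorshipRobust_of_subs :
    (∀ (X : Type) [TopologicalSpace X] [ChartedSpace Literature.Geometry.Lorentzian.E3 X] [IsManifold (𝓡 3) ((⊤ : ℕ∞) : WithTop ℕ∞) X] [T2Space X] [SecondCountableTopology X] [ConnectedSpace X], ∀ d ∈ Literature.Geometry.Lorentzian.admissibleVacuumData X, let Tame : (m : ℕ) → (EuclideanSpace ℝ (Fin m) → Literature.Geometry.Lorentzian.InitialDataSet (𝓡 3) X) → Prop := fun m G ↦ Literature.Geometry.Lorentzian.InitialDataSet.IsSmoothDataFamily m G ∧ G 0 = d ∧ (∀ c, G c ∈ Literature.Geometry.Lorentzian.admissibleVacuumData X) ∧ ∃ K : Set X, IsCompact K ∧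 ∀ c, ∀ x ∉ K, (G c).h.inner x = d.h.inner x ∧ (G c).k x = d.k x; let Q : Literature.Geometry.Lorentzian.InitialDataSet (𝓡 3) X → Prop := fun D ↦ ∀ 𝒟 : Literature.Geometry.Lorentzian.VacuumCauchyDevelopment D, 𝒟.IsMaximal → Summit.FinalStateConjecture.HasCompleteNullInfinity 𝒟.toCauchyDevelopment; ∃ (J : ℕ) (Λ : Fin J → Literature.Geometry.Lorentzian.InitialDataSet (𝓡 3) X → ℝ), (∀ (m : ℕ) (G : EuclideanSpace ℝ (Fin m) → Literature.Geometry.Lorentzian.InitialDataSet (𝓡 3) X), Tame m G → ∀ j, DifferentiableAt ℝ (Λ j ∘ G) 0) ∧ (∀ j, ∃ γ : EuclideanSpace ℝ (Fin 1) → Literature.Geometry.Lorentzian.InitialDataSet (𝓡 3) X, Tame 1 γ ∧ fderiv ℝ (Λ j ∘ γ) 0 ≠ 0) ∧ ∀ (m : ℕ) (G : EuclideanSpace ℝ (Fin m) → Literature.Geometry.Lorentzian.InitialDataSet (𝓡 3) X), Tame m G → ∃ δ : ℝ, 0 < δ ∧ ∀ c, ‖c‖ < δ → (∀ j, Λ j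 (G c) ≠ Λ j d) → Q (G c)) →
    (∀ (X : Type) [TopologicalSpace X] [ChartedSpace Literature.Geometry.Lorentzian.E3 X] [IsManifold (𝓡 3) ((⊤ : ℕ∞) : WithTop ℕ∞) X] [T2Space X] [SecondCountableTopology X] [ConnectedSpace X], ∀ d ∈ Literature.Geometry.Lorentzian.admissibleVacuumData X, let Tame : (m : ℕ) → (EuclideanSpace ℝ (Fin m) → Literature.Geometry.Lorentzian.InitialDataSet (𝓡 3) X) → Prop := fun m G ↦ Literature.Geometry.Lorentzian.InitialDataSet.IsSmoothDataFamily m G ∧ G 0 = d ∧ (∀ c, G c ∈ Literature.Geometry.Lorentzian.admissibleVacuumData X) ∧ ∃ K : Set X, IsCompact K ∧ ∀ c, ∀ x ∉ K, (G c).h.inner x = d.h.inner x ∧ (G c).k x = d.k x; ∀ (m : ℕ) (G : EuclideanSpace ℝ (Fin m) → Literature.Geometry.Lorentzian.InitialDataSet (𝓡 3) X) (γ : EuclideanSpace ℝ (Fin 1) → Literature.Geometry.Lorentzian.InitialDataSet (𝓡 3) X), Tame m G → Tame 1 γ → ∃ (n : ℕ) (G₁ : EuclideanSpace ℝ (Fin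 n) → Literature.Geometry.Lorentzian.InitialDataSet (𝓡 3) X) (L : EuclideanSpace ℝ (Fin m) →ₗ[ℝ] EuclideanSpace ℝ (Fin n)) (L₁ : EuclideanSpace ℝ (Fin 1) →ₗ[ℝ] EuclideanSpace ℝ (Fin n)), Function.Injective L ∧ Tame n G₁ ∧ (∀ c, G₁ (L c) = G c) ∧ ∃ ε : ℝ, 0 < ε ∧ ∀ s, ‖s‖ < ε → G₁ (L₁ s) = γ s) →
    Theses.RobustClausewiseGenericity.CensorshipRobust := by
  intro hW hA X _ _ _ _ _ _ d hd
  have h1 := hW X d hd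
  have h2 := hA X d hd
  dsimp only at h1 h2 ⊢
  obtain ⟨J, Λ, hdiff, hcross, hwall⟩ := h1
  exact robustlyEscapable_of_dataWalls (d := d)
    (Q := fun D => ∀ 𝒟 : VacuumCauchyDevelopment D, 𝒟.IsMaximal →
      Summit.FinalStateConjecture.HasCompleteNullInfinity 𝒟.toCauchyDevelopment)
    Λ hdiff hcross hwall h2

end Summit.FinalStateConjecture.FinalStateConjecture.Theorems.RobustClausewiseGenericity

end

-- buildfix 2026-08-20 (ops-buildfix-1 gen 7): enqueue-only re-land — rebuild after B-9 (p218042) healed this module's import closure; no declaration changed.
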